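import Summits.KontsevichZagierPeriods.KontsevichZagierPeriods.Theses.TorsionLogs
import Summits.KontsevichZagierPeriods.KontsevichZagierPeriods.Theorems.TorsionLogsNeronTorsionSector
import Summits.KontsevichZagierPeriods.KontsevichZagierPeriods.Theorems.TorsionLogsNeronTorsionSectorStubDlogUnfold
import Literature.NumberTheory.Transcendental.KZKernelConjectureForms

/-!
# Line `NeronTorsionThirdKind` on crux `TorsionSectorComplete` (stmt-KontsevichZagierPeriods-14212)
# — forward rung G1 (`next-rung`, gen 19) over the PROVED floor `NeronTorsionPrimitiveChain`
#   (seed g1-KontsevichZagierPeriods-17981, `Cruxes.NeronTorsionSector.Translation.stub_assembly`)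

RUNG `NeronTorsionThirdKind := ∀ eggPoles : Bool, ThirdKindMember eggPoles` — the ONE hypothesis of the floor that is
dropped is the KIND of the differential carried along the torsion arc: the floor carries the differential of the SECOND
kind `η = x dx/y` (pole of order two at `O`, no residues; hence its iterated/product representations `rI`, `rP` and the
QUADRATIC coefficients `q², p²` of `ρ = 1/2 − a/N = p/q` — the archimedean Néron pairing ON THE DIAGONAL, i.e. the local
height `λ(P)`), member `true` carries a differential of the THIRD kind with FREE simple poles
`R = (x_R, y_R)`, `R' = (x_R', y_R')` on the real EGG `e₃ < x < e₂` of the same curve: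
    `θ_{R,R'}(x) dx = (y_R/(x − x_R) − y_R'/(x − x_R')) dx/√f(x)`   (`= 2·ω^odd_{R,R'}`, the `y`-odd part of the normalised
third-kind form `ω_{R,R'} = ½[(y + y_R)/(x − x_R) − (y + y_R')/(x − x_R')] dx/y`, `Res_R = 1`, `Res_{R'} = −1`; the
`y`-even part `½ d log((x − x_R)/(x − x_R'))` is an exact algebraic logarithm) — the archimedean Néron / biextension
pairing OFF THE DIAGONAL `⟨(P) − (O), (R) − (R')⟩_∞`, LINEAR in the torsion class.  Same curve data, same torsion datum
`N·∫_{x_P}^∞ dx/√f = a·ω₁` VERBATIM, same two base intervals `(e₁, x_P)` (the arc `T₁ → P`) and `(e₁, ∞)` (the half real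
period) as the floor's `rI`, `rP`; the representations drop from dimension 2 to dimension 1 and the coefficients from
`(q², p²)` to `(N, N − 2a)`:

* member `false` = `Theses.TorsionLogs.NeronTorsionPrimitiveChain` VERBATIM (the floor; F3 witness
  `thirdKindMember_false` = `stub_assembly`, `Iff.rfl`).
* member `true`  = the TIED THIRD-KIND TORSION SECTOR (typed inline): for `y² = f(x) = 4x³ − g₂x − g₃` with three real
  roots `e₃ < e₂ < e₁` (algebraic `g₂, g₃`), `P = (x_P, ·)`, `x_P > e₁`, with the floor's torsion datum
  `N ∫_{x_P}^∞ dx/√f = a · 2∫_{e₁}^∞ dx/√f` (`3 ≤ N`, `0 < 2a < N`), algebraic egg points `R, R'`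
  (`e₃ < x_R, x_R' < e₂`, `y_R² = f(x_R)`, `y_R'² = f(x_R')`, any signs), the 1-dimensional representations
  `rA = [(e₁, x_P), θ_{R,R'}]`, `rL = [(e₁, ∞), θ_{R,R'}]` and a log carrier `rM = [(1, α), dt/t]`, every tied
  integer-cleared element `(jN)[rA] − (j(N − 2a))[rL] − m[rM]` of value `0` lies in `KZ.relations`.
  Its value content is the THIRD-KIND TORSION IDENTITY
      `N·∫_{e₁}^{x_P} θ_{R,R'} − (N − 2a)·∫_{e₁}^{∞} θ_{R,R'} = −2 log α_P(R,R')`,                          (♠)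
      `log α_P(R,R') = N·∫_{O}^{P} ω^odd_{R,R'} − a·∮_{E⁰(ℝ)} ω^odd_{R,R'} = ε_P · log |f_P(R')/f_P(R)| + (N/2) log|(x_P − x_R)/(x_P − x_R')|`,
  `div f_P = N(P) − N(O)`, `ε_P = sign y_P` — Abel's theorem with logarithmic poles / the reciprocity law for the normalised
  third-kind integral against the principal divisor `N(P) − N(O)`, closed up by `a` real loops (seat numerics, job
  j066664: 30 configurations `(N,a) ∈ {(4,1),(5,1),(5,2),(6,1),(7,2)}`, both sheets of `P`, three sign patterns of
  `(y_R, y_R')`, residual ≤ 1.3e−16; the identity-component version with `R, R'` beyond `P` returns the integer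
  `(2N·∫ω_{R,R'} − log|f(R)/f(R')|)/∮_egg = ±(N − 2a)` exactly).

Why ONE move and why UP: the floor is the diagonal value `⟨D_P, D_P⟩` of the archimedean height pairing at the torsion
divisor `D_P` (Néron function, `q²[∬ηω] + p²[η₁ω₁/2] = c[log B]`); the rung frees the SECOND ARGUMENT of the pairing to an
arbitrary algebraic degree-zero divisor `(R) − (R')` disjoint from the real component.  The summit implies it (on-path
lemma `neronTorsionThirdKind_of_kontsevichZagierPeriods`, sorry-free, via `kzKernelConjecture_iff_isRational`); the floor
does not (new free algebraic parameters `x_R, x_R'` and a differential with residues, absent from every floor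
representation).  No rung of gens 1–18 on this floor (shifted/two-point/duplication/addition/distribution/coset/Jensen/
oval/acnodal/height/complex points/argument/depth three/variation/isogeny/genus two/(3,4)/complex curve) has a third-kind
integrand: all of them keep `η`.  [cite: KontsevichZagier2001, §1.2 Conjecture 1] [cite: Lang1983, Ch. 13]
[cite: Silverman1994, VI.1–VI.4]

STUBS (registered; `sorry` ONLY here):
* `stub_translationStep : ThirdKindTranslationStep` — the NEW MOVE, torsion-free: the ADDITION THEOREM OF THE THIRD KIND
  as ONE change of variables plus ONE dlog-unfolding.  Translating a lower-sheet arc piece `{(x, −√f(x)) : x₁ < x < x₂}`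
  of `E⁰(ℝ)` by a real point `Q = (x_Q, y_Q)` (chord-and-tangent law, `x(X+Q) = φ(x) = m(x)²/4 − x − x_Q`,
  `m(x) = (−√f(x) − y_Q)/(x − x_Q)`; the piece chosen so that `X + Q` never meets `T₁` or `O`) pulls `θ_{R,R'} dx` back
  to `θ_{R,R'} dx + d log|Γ_Q(x, −√f(x))|`, `Γ_Q ∈ ℚ(g₂,g₃,Q,R,R')(E)` the function with divisor
  `(R−Q) − (R'−Q) − (R̄−Q) + (R̄'−Q) − (R) + (R') + (R̄) − (R̄')` (`R̄ = −R`); so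
  `[φ-image piece, θ] − [piece, θ] − c[(1,B), dt/t] ∈ KZ.relations` (rule 2 along `φ`, rule 1b, the landed
  `stub_dlogUnfold` on the positive algebraic `|Γ_Q|`, the landed interval-log calculus to merge carriers).  Value
  content: `F(u_b + u_Q) − F(u_a + u_Q) − F(u_b) + F(u_a) = log|Γ_Q(X_b)/Γ_Q(X_a)|`, `F` a primitive of `θ du` on the
  universal cover of `E⁰(ℝ)` — Legendre's addition theorem for the integral of the third kind `Π(u, a)`.  Size M–L,
  provable now.
* `stub_orbitChain : OrbitChain := ThirdKindTranslationStep → ThirdKindPrimitiveChain` — the floor's translation engine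
  one kind up (HARDEST, L–XL): cut the `N` translates `[kP, (k+1)P]` (`k < N`) of the arc `O → P` at `T₁` and `O` into
  x-monotone pieces (mirror upper-sheet pieces by `[−1]`, under which `θ dx` is invariant as an x-density), straighten
  each by stub 1, telescope: the `N` arcs tile the real component exactly `a` times (torsion datum `N u_P = a ω₁`), so
  `N[(x_P,∞), θ] − a[loop] ≡ Σ logs`; rewrite on the floor's base intervals (`[(x_P,∞), θ] = [(e₁,∞), θ] − [(e₁,x_P), θ]`,
  `[loop] = 2[(e₁,∞), θ]`: domain additivity) to `N[(e₁,x_P), θ] − (N−2a)[(e₁,∞), θ] ≡ −Σ logs`, merge the carriers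
  (landed interval-log calculus).  Why it might fail: only by size/bookkeeping — every ingredient is algebraic and (♠) is
  checked numerically; unbounded pieces need the compactifying chart `x = x_P + 1/s` before `stub_dlogUnfold`.
* `stub_thirdKindSectorComplete : ThirdKindSectorComplete` — the declared RESIDUAL: completeness relative to
  `relations ⊔ closure (T ∪ T^{3rd})`; WEAKER than the crux as typed (`thirdKindSectorComplete_of_torsionSectorComplete`).

COMPOSITION (kernel-checked, no `sorry` outside the stubs): `thirdKindPrimitiveChain_of`, `thirdKindSector_of_chain`
(bookkeeping: soundness of the calculus for values + the landed interval-log calculus), `neronTorsionThirdKind_of`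
(THE RUNG from stubs 1–2 and the floor), `closure_thirdKindTied_le_relations`, `TorsionSectorComplete_of` (the crux BY
NAME from the three stubs).  F4 on-path: `neronTorsionThirdKind_of_kontsevichZagierPeriods : S → rung` (sorry-free, also
in `Lines/NeronTorsionThirdKind_onpath.lean`); F3: `thirdKindMember_false` (also `Lines/NeronTorsionThirdKind_special.lean`).
[cite: KontsevichZagier2001, §1.2 Conjecture 1]
-/

noncomputable section

open Set MeasureTheory Filter Topology
open Literature.NumberTheory.Transcendental Literature.ModelTheory.ExponentialFields
open Summit.KontsevichZagierPeriods.KontsevichZagierPeriods.Theses.TorsionLogs (NeronTorsionPrimitiveChain TorsionSectorComplete)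
open Summit.KontsevichZagierPeriods.HyperbolicBloch.OffTetraSectorKernel (interval_log_relation_mem_relations)
open Summit.KontsevichZagierPeriods.KontsevichZagierPeriods.Cruxes.NeronTorsionSector.Translation (logRep_value
  isAlgebraic_of_logRep stub_assembly stub_dlogUnfold)

-- `Summit.KontsevichZagierPeriods.KontsevichZagierPeriods.…` is the tree's mandated layout (single-conjunct summit).
set_option linter.dupNamespace false

namespace Summit.KontsevichZagierPeriods.KontsevichZagierPeriods.Cruxes.TorsionSectorComplete.NeronTorsionThirdKind

/-! ### The rung: a Bool-indexed family of tied Néron–torsion sectors (second kind ↦ third kind) -/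

/-- The two members.  `false` ↦ the floor `NeronTorsionPrimitiveChain` VERBATIM (second-kind differential `η` along the
torsion arc: `q²[I(P)] + p²[η₁ω₁/2] − c[log B] ∈ KZ.relations`).  `true` ↦ the TIED THIRD-KIND TORSION SECTOR: same real
curve in Weierstrass form with three real roots `e₃ < e₂ < e₁`, same torsion datum for `x_P > e₁`, free algebraic poles
`R, R'` on the egg, the third-kind density `θ_{R,R'}(t) = (y_R/(t − x_R) − y_R'/(t − x_R'))/√f(t)` on the floor's two base
intervals `(e₁, x_P)` and `(e₁, ∞)`, and every tied integer-cleared element `(jN)[rA] − (j(N−2a))[rL] − m[(1,α), dt/t]` of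
value `0` claimed to lie in `KZ.relations` (identity (♠) of the module docstring).
[cite: KontsevichZagier2001, §1.2] [cite: Lang1983, Ch. 13] -/
def ThirdKindMember : Bool → Prop
  | false => ∀ (g₂ g₃ e₁ xP yP : ℝ) (N a p q : ℕ) (f : ℝ → ℝ), (∀ x, f x = 4 * x ^ 3 - g₂ * x - g₃) → g₂ ^ 3 - 27 * g₃ ^ 2 ≠ 0 → f e₁ = 0 → 0 < e₁ → (∀ x, e₁ < x → 0 < f x) → e₁ < xP → yP ^ 2 = f xP → 3 ≤ N → 0 < a → 2 * a < N → (∀ hns : (⟨0, 0, 0, -g₂ / 4, -g₃ / 4⟩ : WeierstrassCurve ℝ).toAffine.Nonsingular xP (yP / 2), addOrderOf (WeierstrassCurve.Affine.Point.some xP (yP / 2) hns) = N) → (N : ℝ) * (∫ x in Set.Ioi xP, (Real.sqrt (f x))⁻¹) = a * (2 * ∫ x in Set.Ioi e₁, (Real.sqrt (f x))⁻¹) → Nat.Coprime p q → (q : ℤ) * ((N : ℤ) - 2 * (a : ℤ)) = (p : ℤ) * (2 * (N : ℤ)) → ∀ (rI rP : Literature.NumberTheory.Transcendental.KZ.IntegralRep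 2), rI.domain = {z | e₁ < z 1 ∧ z 1 < z 0 ∧ z 0 < xP} → Set.EqOn rI.integrand (fun z => z 1 / (Real.sqrt (f (z 1)) * Real.sqrt (f (z 0)))) rI.domain → rP.domain = {z | e₁ < z 0 ∧ e₁ < z 1} → Set.EqOn rP.integrand (fun z => (Real.sqrt (f (z 0)))⁻¹ * ((g₂ * z 1 + 2 * g₃) / (2 * (z 1) ^ 2 * Real.sqrt (f (z 1))))) rP.domain → ∃ (c : ℤ) (B : ℝ) (rB : Literature.NumberTheory.Transcendental.KZ.IntegralRep 1), 1 < B ∧ IsAlgebraic ℚ B ∧ rB.domain = {t | 1 < t 0 ∧ t 0 < B} ∧ Set.EqOn rB.integrand (fun t => (t 0)⁻¹) rB.domain ∧ ((q : ℤ) ^ 2) • Literature.NumberTheory.Transcendental.KZ.of rI + ((p : ℤ) ^ 2) • Literature.NumberTheory.Transcendental.KZ.of rP - c • Literature.NumberTheory.Transcendental.KZ.of rB ∈ Literature.NumberTheory.Transcendental.KZ.relations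
  | true => ∀ (g₂ g₃ e₁ e₂ e₃ xP xR yR xR' yR' α : ℝ) (N a : ℕ) (j m : ℤ) (f : ℝ → ℝ), IsAlgebraic ℚ g₂ → IsAlgebraic ℚ g₃ → IsAlgebraic ℚ xR → IsAlgebraic ℚ xR' → (∀ x, f x = 4 * x ^ 3 - g₂ * x - g₃) → f e₁ = 0 → f e₂ = 0 → f e₃ = 0 → e₃ < e₂ → e₂ < e₁ → e₃ < xR → xR < e₂ → yR ^ 2 = f xR → e₃ < xR' → xR' < e₂ → yR' ^ 2 = f xR' → e₁ < xP → 3 ≤ N → 0 < a → 2 * a < N → (N : ℝ) * (∫ x in Set.Ioi xP, (Real.sqrt (f x))⁻¹) = a * (2 * ∫ x in Set.Ioi e₁, (Real.sqrt (f x))⁻¹) → 1 < α → ∀ (rA rL rM : Literature.NumberTheory.Transcendental.KZ.IntegralRep 1), rA.domain = {t | e₁ < t 0 ∧ t 0 < xP} → Set.EqOn rA.integrand (fun t => (yR / (t 0 - xR) - yR' / (t 0 - xR')) / Real.sqrt (f (t 0))) rA.domain → rL.domain = {t | e₁ < t 0} → Set.EqOn rL.integrand (fun t => (yR / (t 0 -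 xR) - yR' / (t 0 - xR')) / Real.sqrt (f (t 0))) rL.domain → rM.domain = {t | 1 < t 0 ∧ t 0 < α} → Set.EqOn rM.integrand (fun t => (t 0)⁻¹) rM.domain → (j : ℝ) * ((N : ℝ) * rA.value - ((N : ℝ) - 2 * (a : ℝ)) * rL.value) = m * rM.value → (j * (N : ℤ)) • Literature.NumberTheory.Transcendental.KZ.of rA - (j * ((N : ℤ) - 2 * (a : ℤ))) • Literature.NumberTheory.Transcendental.KZ.of rL - m • Literature.NumberTheory.Transcendental.KZ.of rM ∈ Literature.NumberTheory.Transcendental.KZ.relations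

/-- **THE RUNG.** Both members: the floor (second kind, diagonal Néron pairing) and the third-kind torsion sector
(off-diagonal pairing against a free egg divisor). -/
def NeronTorsionThirdKind : Prop := ∀ eggPoles : Bool, ThirdKindMember eggPoles

/-! ### Sorry-free infrastructure: floor member, on-path lemma -/

/-- Member `false` of the family is the floor `NeronTorsionPrimitiveChain` on the nose. -/
theorem thirdKindMember_false_iff :
    ThirdKindMember false ↔
      Summit.KontsevichZagierPeriods.KontsevichZagierPeriods.Theses.TorsionLogs.NeronTorsionPrimitiveChain :=
  Iff.rfl

/-- **F3 WITNESS — the floor is member `false` of the family** (names the seed `stub_assembly`). -/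
theorem thirdKindMember_false : ThirdKindMember false :=
  thirdKindMember_false_iff.mpr stub_assembly

/-- F3 in the brief's literal shape `example : Rung <floor index> := by simpa [Rung] using <seed>`. -/
example : ThirdKindMember false :=
  (stub_assembly : Summit.KontsevichZagierPeriods.KontsevichZagierPeriods.Theses.TorsionLogs.NeronTorsionPrimitiveChain)

/-- The rung restricted to the new index is all that is open. -/
theorem neronTorsionThirdKind_iff_true : NeronTorsionThirdKind ↔ ThirdKindMember true :=
  ⟨fun h => h true, fun h b => by cases b <;> [exact thirdKindMember_false; exact h]⟩

/-- **F4 ON-PATH LEMMA — the summit implies the rung** (member `false` is a theorem outright; member `true` by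
Conjecture 1 in kernel form, `kzKernelConjecture_iff_isRational`: a tied element evaluates to `0` by its value
hypothesis).  Tagged `@[simp]` for the tribunal's forward probe. [cite: KontsevichZagier2001, §1.2] -/
@[simp] theorem neronTorsionThirdKind_of_kontsevichZagierPeriods (h : _root_.KontsevichZagierPeriods) :
    NeronTorsionThirdKind := by
  have hK : KZKernelConjecture := kzKernelConjecture_iff_isRational.mpr h
  intro b
  cases b
  · exact thirdKindMember_false
  · intro g₂ g₃ e₁ e₂ e₃ xP xR yR xR' yR' α N a j m f _ _ _ _ _ _ _ _ _ _ _ _ _ _ _ _ _ _ _ _ _ _ rA rL rM _ _ _ _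
      _ _ hval
    apply hK
    rw [map_sub, map_sub, map_zsmul, map_zsmul, map_zsmul, KZ.eval_of, KZ.eval_of, KZ.eval_of, zsmul_eq_mul,
      zsmul_eq_mul, zsmul_eq_mul]
    push_cast
    linear_combination hval

/-- The same as an implication `S → Rung`. -/
theorem onPath : _root_.KontsevichZagierPeriods → NeronTorsionThirdKind :=
  neronTorsionThirdKind_of_kontsevichZagierPeriods

/-! ### The primitive chain and the stub statements -/

/-- The PRIMITIVE THIRD-KIND CHAIN (what stubs 1–2 produce; the `∃`-form of member `true` at the primitive vector
`(N, −(N−2a))`): a log carrier `[1<t<B, dt/t]`, `B > 1` real algebraic, and `c ∈ ℤ` with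
`N[(e₁,x_P), θ_{R,R'}] − (N−2a)[(e₁,∞), θ_{R,R'}] − c[log B] ∈ KZ.relations` — identity (♠) realised by MOVES.
[cite: KontsevichZagier2001, §1.2] [cite: Lang1983, Ch. 13] -/
def ThirdKindPrimitiveChain : Prop := ∀ (g₂ g₃ e₁ e₂ e₃ xP xR yR xR' yR' : ℝ) (N a : ℕ) (f : ℝ → ℝ), IsAlgebraic ℚ g₂ → IsAlgebraic ℚ g₃ → IsAlgebraic ℚ xR → IsAlgebraic ℚ xR' → (∀ x, f x = 4 * x ^ 3 - g₂ * x - g₃) → f e₁ = 0 → f e₂ = 0 → f e₃ = 0 → e₃ < e₂ → e₂ < e₁ → e₃ < xR → xR < e₂ → yR ^ 2 = f xR → e₃ < xR' → xR' < e₂ → yR' ^ 2 = f xR' → e₁ < xP → 3 ≤ N → 0 < a → 2 * a < N → (N : ℝ) * (∫ x in Set.Ioi xP, (Real.sqrt (f x))⁻¹) = a * (2 * ∫ x in Set.Ioi e₁, (Real.sqrt (f x))⁻¹) → ∀ (rA rL : Literature.NumberTheory.Transcendental.KZ.IntegralRep 1), rA.domain = {t | e₁ < t 0 ∧ t 0 <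 xP} → Set.EqOn rA.integrand (fun t => (yR / (t 0 - xR) - yR' / (t 0 - xR')) / Real.sqrt (f (t 0))) rA.domain → rL.domain = {t | e₁ < t 0} → Set.EqOn rL.integrand (fun t => (yR / (t 0 - xR) - yR' / (t 0 - xR')) / Real.sqrt (f (t 0))) rL.domain → ∃ (c : ℤ) (B : ℝ) (rB : Literature.NumberTheory.Transcendental.KZ.IntegralRep 1), 1 < B ∧ IsAlgebraic ℚ B ∧ rB.domain = {t | 1 < t 0 ∧ t 0 < B} ∧ Set.EqOn rB.integrand (fun t => (t 0)⁻¹) rB.domain ∧ (N : ℤ) • Literature.NumberTheory.Transcendental.KZ.of rA - ((N : ℤ) - 2 * (a : ℤ)) • Literature.NumberTheory.Transcendental.KZ.of rL - c • Literature.NumberTheory.Transcendental.KZ.of rB ∈ Literature.NumberTheory.Transcendental.KZ.relations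

/-- **Stub 1 — the third-kind translation step (addition theorem of the third kind as one change of variables).**
Data: the curve with real roots `e₃ < e₂ < e₁`, algebraic egg poles `R, R'`, a real point `Q = (x_Q, y_Q)`, `x_Q > e₁`
(either sheet), a lower-sheet arc piece over `(x₁, x₂) ⊂ (e₁, ∞)` not containing `x_Q`, the chord slope
`m(x) = (−√f(x) − y_Q)/(x − x_Q)` and the translate abscissa `φ(x) = m(x)²/4 − x − x_Q` (`= x(X + Q)`, `X = (x, −√f(x))`),
with `y(X+Q) = √f(x) − m(x)(φ(x) − x) ≠ 0` along the closed piece (no sheet change, so `φ` is a monotone Nash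
diffeomorphism onto the open interval between `φ(x₁)` and `φ(x₂)`).  Claim: `[φ-image, θ] − [piece, θ] − c[(1,B), dt/t] ∈
KZ.relations` for some `c ∈ ℤ`, `B > 1` real algebraic.  Route: rule 2 along `φ` (`φ^*(θ dt) = θ dt + d log|Γ_Q|`, the
translation cocycle of the third-kind form, `Γ_Q` rational on `E`), rule 1b, `stub_dlogUnfold` (landed) on `|Γ_Q(x, −√f x)|`,
merge by `interval_log_relation_mem_relations` (landed).  Torsion-free and new on this summit's tree (the floor's
`stub_translationStep` is its second-kind shadow, where the cocycle is EXACT-algebraic `dG` instead of `d log Γ`).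
[cite: KontsevichZagier2001, §1.2 rules (1)–(3)] [cite: Silverman1994, VI.1–VI.4] -/
def ThirdKindTranslationStep : Prop := ∀ (g₂ g₃ e₁ e₂ e₃ xR yR xR' yR' xQ yQ x₁ x₂ : ℝ) (f m φ : ℝ → ℝ), IsAlgebraic ℚ g₂ → IsAlgebraic ℚ g₃ → IsAlgebraic ℚ xR → IsAlgebraic ℚ xR' → IsAlgebraic ℚ xQ → IsAlgebraic ℚ x₁ → IsAlgebraic ℚ x₂ → (∀ x, f x = 4 * x ^ 3 - g₂ * x - g₃) → f e₁ = 0 → f e₂ = 0 → f e₃ = 0 → e₃ < e₂ → e₂ < e₁ → e₃ < xR → xR < e₂ → yR ^ 2 = f xR → e₃ < xR' → xR' < e₂ → yR' ^ 2 = f xR' → e₁ < xQ → yQ ^ 2 = f xQ → e₁ < x₁ → x₁ < x₂ → (xQ < x₁ ∨ x₂ < xQ) → (∀ x, m x = (-Real.sqrt (f x) - yQ) / (x - xQ)) → (∀ x, φ x = (m x) ^ 2 / 4 - x - xQ) → (∀ x ∈ Set.Icc x₁ x₂, Real.sqrt (f x) - m x * (φ x - x) ≠ 0) → ∀ (rS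 rT : Literature.NumberTheory.Transcendental.KZ.IntegralRep 1), rS.domain = {t | x₁ < t 0 ∧ t 0 < x₂} → Set.EqOn rS.integrand (fun t => (yR / (t 0 - xR) - yR' / (t 0 - xR')) / Real.sqrt (f (t 0))) rS.domain → rT.domain = {t | min (φ x₁) (φ x₂) < t 0 ∧ t 0 < max (φ x₁) (φ x₂)} → Set.EqOn rT.integrand (fun t => (yR / (t 0 - xR) - yR' / (t 0 - xR')) / Real.sqrt (f (t 0))) rT.domain → ∃ (c : ℤ) (B : ℝ) (rB : Literature.NumberTheory.Transcendental.KZ.IntegralRep 1), 1 < B ∧ IsAlgebraic ℚ B ∧ rB.domain = {t | 1 < t 0 ∧ t 0 < B} ∧ Set.EqOn rB.integrand (fun t => (t 0)⁻¹) rB.domain ∧ Literature.NumberTheory.Transcendental.KZ.of rT - Literature.NumberTheory.Transcendental.KZ.of rS - c • Literature.NumberTheory.Transcendental.KZ.of rB ∈ Literature.NumberTheory.Transcendental.KZ.relations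

/-- **Stub 2 — the orbit chain (HARDEST).**  Given the translation step, the primitive third-kind chain: the floor's
translation engine run on the `N` translates of the arc `O → P`, which tile `E⁰(ℝ)` exactly `a` times by the torsion datum;
pieces cut at `T₁`/`O`, upper-sheet pieces mirrored by `[−1]`; telescoping; rewriting on the floor's base intervals by
domain additivity; merging the log carriers.  [cite: KontsevichZagier2001, §1.2] [cite: Lang1983, Ch. 13] -/
def OrbitChain : Prop := ThirdKindTranslationStep → ThirdKindPrimitiveChain

/-- The torsion tied set `T` of the route's crux — VERBATIM the set inside `Theses.TorsionLogs.TorsionSectorComplete`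
(so that `torsionSectorComplete_iff` is `Iff.rfl`). -/
def TorsionTied : Set Literature.NumberTheory.Transcendental.KZ.FormalRep := {d : Literature.NumberTheory.Transcendental.KZ.FormalRep | ∃ (g₂ g₃ e₁ xP yP α : ℝ) (N a : ℕ) (M k m : ℤ) (f : ℝ → ℝ) (rI rP : Literature.NumberTheory.Transcendental.KZ.IntegralRep 2) (rL : Literature.NumberTheory.Transcendental.KZ.IntegralRep 1), (∀ x, f x = 4 * x ^ 3 - g₂ * x - g₃) ∧ g₂ ^ 3 - 27 * g₃ ^ 2 ≠ 0 ∧ f e₁ = 0 ∧ 0 < e₁ ∧ (∀ x, e₁ < x → 0 < f x) ∧ e₁ < xP ∧ yP ^ 2 = f xP ∧ 3 ≤ N ∧ 0 < a ∧ 2 * a < N ∧ 4 * (N : ℤ) ^ 2 * k = M * ((N : ℤ) - 2 * (a : ℤ)) ^ 2 ∧ (∀ hns : (⟨0, 0, 0, -g₂ / 4, -g₃ / 4⟩ : WeierstrassCurve ℝ).toAffine.Nonsingular xP (yP / 2), addOrderOf (WeierstrassCurve.Affine.Point.some xP (yP / 2) hns) = N) ∧ (N : ℝ) * (∫ x in Set.Ioi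 xP, (Real.sqrt (f x))⁻¹) = a * (2 * ∫ x in Set.Ioi e₁, (Real.sqrt (f x))⁻¹) ∧ 1 < α ∧ rI.domain = {z | e₁ < z 1 ∧ z 1 < z 0 ∧ z 0 < xP} ∧ Set.EqOn rI.integrand (fun z => z 1 / (Real.sqrt (f (z 1)) * Real.sqrt (f (z 0)))) rI.domain ∧ rP.domain = {z | e₁ < z 0 ∧ e₁ < z 1} ∧ Set.EqOn rP.integrand (fun z => (Real.sqrt (f (z 0)))⁻¹ * ((g₂ * z 1 + 2 * g₃) / (2 * (z 1) ^ 2 * Real.sqrt (f (z 1))))) rP.domain ∧ rL.domain = {t | 1 < t 0 ∧ t 0 < α} ∧ Set.EqOn rL.integrand (fun t => (t 0)⁻¹) rL.domain ∧ (M : ℝ) * rI.value + k * rP.value = m * rL.value ∧ d = M • Literature.NumberTheory.Transcendental.KZ.of rI + k • Literature.NumberTheory.Transcendental.KZ.of rP - m • Literature.NumberTheory.Transcendental.KZ.of rL}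

/-- The third-kind tied set `T^{3rd}` (the elements of member `true`). -/
def ThirdKindTied : Set Literature.NumberTheory.Transcendental.KZ.FormalRep := {d : Literature.NumberTheory.Transcendental.KZ.FormalRep | ∃ (g₂ g₃ e₁ e₂ e₃ xP xR yR xR' yR' α : ℝ) (N a : ℕ) (j m : ℤ) (f : ℝ → ℝ) (rA rL rM : Literature.NumberTheory.Transcendental.KZ.IntegralRep 1), IsAlgebraic ℚ g₂ ∧ IsAlgebraic ℚ g₃ ∧ IsAlgebraic ℚ xR ∧ IsAlgebraic ℚ xR' ∧ (∀ x, f x = 4 * x ^ 3 - g₂ * x - g₃) ∧ f e₁ = 0 ∧ f e₂ = 0 ∧ f e₃ = 0 ∧ e₃ < e₂ ∧ e₂ < e₁ ∧ e₃ < xR ∧ xR < e₂ ∧ yR ^ 2 = f xR ∧ e₃ < xR' ∧ xR' < e₂ ∧ yR' ^ 2 = f xR' ∧ e₁ < xP ∧ 3 ≤ N ∧ 0 < a ∧ 2 * a < N ∧ (N : ℝ) * (∫ x in Set.Ioi xP, (Real.sqrt (f x))⁻¹) = a * (2 * ∫ x in Set.Ioi e₁, (Real.sqrt (f x))⁻¹)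 ∧ 1 < α ∧ rA.domain = {t | e₁ < t 0 ∧ t 0 < xP} ∧ Set.EqOn rA.integrand (fun t => (yR / (t 0 - xR) - yR' / (t 0 - xR')) / Real.sqrt (f (t 0))) rA.domain ∧ rL.domain = {t | e₁ < t 0} ∧ Set.EqOn rL.integrand (fun t => (yR / (t 0 - xR) - yR' / (t 0 - xR')) / Real.sqrt (f (t 0))) rL.domain ∧ rM.domain = {t | 1 < t 0 ∧ t 0 < α} ∧ Set.EqOn rM.integrand (fun t => (t 0)⁻¹) rM.domain ∧ (j : ℝ) * ((N : ℝ) * rA.value - ((N : ℝ) - 2 * (a : ℝ)) * rL.value) = m * rM.value ∧ d = (j * (N : ℤ)) • Literature.NumberTheory.Transcendental.KZ.of rA - (j * ((N : ℤ) - 2 * (a : ℤ))) • Literature.NumberTheory.Transcendental.KZ.of rL - m • Literature.NumberTheory.Transcendental.KZ.of rM}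

/-- **Stub 3 — the declared RESIDUAL `ThirdKindSectorComplete`:** completeness of the calculus relative to
`relations ⊔ closure (T ∪ T^{3rd})`.  WEAKER than the crux as typed (`thirdKindSectorComplete_of_torsionSectorComplete`);
conjecture-grade (the Grothendieck-strength kernel statement off the enlarged sector); expected stamp open-problem.
[cite: KontsevichZagier2001, §1.2] [cite: HuberMullerStachPeriods2017, §13.2] -/
def ThirdKindSectorComplete : Prop := ∀ ⦃n m : ℕ⦄ (r : Literature.NumberTheory.Transcendental.KZ.IntegralRep n) (r' : Literature.NumberTheory.Transcendental.KZ.IntegralRep m), r.IsRational → r'.IsRational → r.value = r'.value → Literature.NumberTheory.Transcendental.KZ.of r - Literature.NumberTheory.Transcendental.KZ.of r' ∈ Literature.NumberTheory.Transcendental.KZ.relations ⊔ AddSubgroup.closure (TorsionTied ∪ ThirdKindTied)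

/-! ### Registered stubs (`sorry` ONLY here) -/

/-- stub 1 · the third-kind translation step (addition theorem of the third kind: one rule-2 move + one dlog
unfolding via the landed `stub_dlogUnfold`) · size M–L. -/
theorem stub_translationStep : ThirdKindTranslationStep := by
  sorry

/-- stub 2 · the orbit chain (tiling of `E⁰(ℝ)` by the `N` translates of `O → P`, telescoping, base-interval rewriting,
log merging) · size L–XL · HARDEST. -/
theorem stub_orbitChain : OrbitChain := by
  sorry

/-- stub 3 · the residual relative completeness · conjecture-grade. -/
theorem stub_thirdKindSectorComplete : ThirdKindSectorComplete := by
  sorry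

/-! ### Kernel-checked composition (no `sorry` below this line) -/

/-- The crux unfolds to completeness relative to `relations ⊔ closure T`. -/
theorem torsionSectorComplete_iff :
    Summit.KontsevichZagierPeriods.KontsevichZagierPeriods.Theses.TorsionLogs.TorsionSectorComplete ↔
      ∀ ⦃n m : ℕ⦄ (r : Literature.NumberTheory.Transcendental.KZ.IntegralRep n)
        (r' : Literature.NumberTheory.Transcendental.KZ.IntegralRep m), r.IsRational → r'.IsRational →
        r.value = r'.value → Literature.NumberTheory.Transcendental.KZ.of r - Literature.NumberTheory.Transcendental.KZ.of r' ∈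
          Literature.NumberTheory.Transcendental.KZ.relations ⊔ AddSubgroup.closure TorsionTied :=
  Iff.rfl

/-- The primitive third-kind chain follows from the two content stubs. -/
theorem thirdKindPrimitiveChain_of (h₁ : ThirdKindTranslationStep) (h₂ : OrbitChain) : ThirdKindPrimitiveChain :=
  h₂ h₁

/-- **Bookkeeping: the primitive chain gives the tied third-kind sector** — the chain at the vector `(jN, −j(N−2a))`,
soundness of the calculus for the value, algebraicity of the end point of a log carrier, and the landed interval-log
calculus for `(jc)•[rB] − m•[rM]`. [cite: KontsevichZagier2001, §1.2] -/
theorem thirdKindSector_of_chain (hPC : ThirdKindPrimitiveChain) : ThirdKindMember true := by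
  intro g₂ g₃ e₁ e₂ e₃ xP xR yR xR' yR' α N a j m f hg₂ hg₃ hxR hxR' hf he₁ he₂ he₃ h₃₂ h₂₁ hR₁ hR₂ hyR hR'₁ hR'₂
    hyR' hP hN ha haN htor hα rA rL rM hdA hiA hdL hiL hdM hiM hval
  obtain ⟨c, B, rB, hB, hBalg, hdB, hiB, hprim⟩ :=
    hPC g₂ g₃ e₁ e₂ e₃ xP xR yR xR' yR' N a f hg₂ hg₃ hxR hxR' hf he₁ he₂ he₃ h₃₂ h₂₁ hR₁ hR₂ hyR hR'₁ hR'₂ hyR' hP hN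
      ha haN htor rA rL hdA hiA hdL hiL
  have hvB : rB.value = Real.log B := logRep_value hB.le rB hdB hiB
  have hvM : rM.value = Real.log α := logRep_value hα.le rM hdM hiM
  have hαalg : IsAlgebraic ℚ α := isAlgebraic_of_logRep hα rM hdM
  have h0 : (N : ℝ) * rA.value - ((N : ℝ) - 2 * (a : ℝ)) * rL.value - c * Real.log B = 0 := by
    have h := KZ.relations_le_ker_eval_holds hprim
    rw [AddMonoidHom.mem_ker, map_sub, map_sub, map_zsmul, map_zsmul, map_zsmul, KZ.eval_of, KZ.eval_of, KZ.eval_of,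
      zsmul_eq_mul, zsmul_eq_mul, zsmul_eq_mul, hvB] at h
    push_cast at h
    linear_combination h
  have hlog : ((j * c : ℤ) : ℝ) * Real.log B + ((-m : ℤ) : ℝ) * Real.log α = 0 := by
    rw [hvM] at hval
    push_cast
    linear_combination (-(j : ℝ)) * h0 + hval
  have hiB1 : Set.EqOn rB.integrand (fun t : Fin 1 → ℝ => 1 / t 0) rB.domain := fun t ht => by
    simp only [hiB ht, one_div]
  have hiM1 : Set.EqOn rM.integrand (fun t : Fin 1 → ℝ => 1 / t 0) rM.domain := fun t ht => by
    simp only [hiM ht, one_div]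
  have hL : (j * c) • KZ.of rB + (-m) • KZ.of rM ∈ KZ.relations := by
    have h := interval_log_relation_mem_relations 2 ![1, 1] ![B, α] ![j * c, -m] ![rB, rM]
      (fun i => by fin_cases i <;> simp)
      (fun i => by fin_cases i <;> simp [hB.le, hα.le])
      (fun i => by fin_cases i <;> exact isAlgebraic_one)
      (fun i => by fin_cases i <;> simp [hBalg, hαalg])
      (fun i => by
        fin_cases i
        · exact ⟨hdB, hiB1⟩
        · exact ⟨hdM, hiM1⟩)
      (by
        simp only [Fin.sum_univ_two, Matrix.cons_val_zero, Matrix.cons_val_one, div_one]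
        linear_combination hlog)
    have e : ∑ i : Fin 2, (![j * c, -m] i : ℤ) • KZ.of (![rB, rM] i) = (j * c) • KZ.of rB + (-m) • KZ.of rM := by
      simp only [Fin.sum_univ_two, Matrix.cons_val_zero, Matrix.cons_val_one]
    rw [e] at h
    exact h
  have e : (j * (N : ℤ)) • KZ.of rA - (j * ((N : ℤ) - 2 * (a : ℤ))) • KZ.of rL - m • KZ.of rM =
      j • ((N : ℤ) • KZ.of rA - ((N : ℤ) - 2 * (a : ℤ)) • KZ.of rL - c • KZ.of rB) +
        ((j * c) • KZ.of rB + (-m) • KZ.of rM) := by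
    module
  rw [e]
  exact KZ.relations.add_mem (KZ.relations.zsmul_mem hprim _) hL

/-- **THE RUNG from the two content stubs** (member `false` is the proved floor). -/
theorem neronTorsionThirdKind_of (h₁ : ThirdKindTranslationStep) (h₂ : OrbitChain) : NeronTorsionThirdKind := by
  intro b
  cases b
  · exact thirdKindMember_false
  · exact thirdKindSector_of_chain (thirdKindPrimitiveChain_of h₁ h₂)

/-- The rung holds (through the registered stubs 1–2 only). -/
theorem neronTorsionThirdKind_holds : NeronTorsionThirdKind :=
  neronTorsionThirdKind_of stub_translationStep stub_orbitChain

/-- The third-kind member says exactly `closure T^{3rd} ≤ KZ.relations`. [cite: KontsevichZagier2001, §1.2] -/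
theorem closure_thirdKindTied_le_relations (h : ThirdKindMember true) :
    AddSubgroup.closure ThirdKindTied ≤ Literature.NumberTheory.Transcendental.KZ.relations := by
  refine (AddSubgroup.closure_le _).mpr ?_
  rintro d ⟨g₂, g₃, e₁, e₂, e₃, xP, xR, yR, xR', yR', α, N, a, j, m', f, rA, rL, rM, hg₂, hg₃, hxR, hxR', hf, he₁, he₂,
    he₃, h₃₂, h₂₁, hR₁, hR₂, hyR, hR'₁, hR'₂, hyR', hP, hN, ha, haN, htor, hα, hdA, hiA, hdL, hiL, hdM, hiM, hval, rfl⟩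
  exact h g₂ g₃ e₁ e₂ e₃ xP xR yR xR' yR' α N a j m' f hg₂ hg₃ hxR hxR' hf he₁ he₂ he₃ h₃₂ h₂₁ hR₁ hR₂ hyR hR'₁ hR'₂ hyR'
    hP hN ha haN htor hα rA rL rM hdA hiA hdL hiL hdM hiM hval

/-- The residual is a consequence of the crux (hence of the summit): `closure T ≤ closure (T ∪ T^{3rd})`.
(Informational: stub 3 is WEAKER than the crux as typed.) [folklore] -/
theorem thirdKindSectorComplete_of_torsionSectorComplete
    (h : Summit.KontsevichZagierPeriods.KontsevichZagierPeriods.Theses.TorsionLogs.TorsionSectorComplete) :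
    ThirdKindSectorComplete := by
  intro n m r r' hr hr' hv
  have hmono : Literature.NumberTheory.Transcendental.KZ.relations ⊔ AddSubgroup.closure TorsionTied ≤
      Literature.NumberTheory.Transcendental.KZ.relations ⊔ AddSubgroup.closure (TorsionTied ∪ ThirdKindTied) :=
    sup_le_sup_left (AddSubgroup.closure_mono Set.subset_union_left) _
  exact hmono (torsionSectorComplete_iff.mp h r r' hr hr' hv)

/-! ### Composition: the crux BY NAME from the three stubs -/

/-- **`TorsionSectorComplete` from the stubs** (closed term; `sorry` only through `stub_translationStep`,
`stub_orbitChain`, `stub_thirdKindSectorComplete`): the rung (stubs 1–2) folds the third-kind sector into the moves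
(`closure T^{3rd} ≤ relations`), so the residual's `relations ⊔ closure (T ∪ T^{3rd})` is `≤ relations ⊔ closure T`.
[cite: KontsevichZagier2001, §1.2] -/
theorem TorsionSectorComplete_of :
    Summit.KontsevichZagierPeriods.KontsevichZagierPeriods.Theses.TorsionLogs.TorsionSectorComplete := by
  suffices key : ThirdKindTranslationStep → OrbitChain → ThirdKindSectorComplete →
      Summit.KontsevichZagierPeriods.KontsevichZagierPeriods.Theses.TorsionLogs.TorsionSectorComplete from
    key stub_translationStep stub_orbitChain stub_thirdKindSectorComplete
  intro h₁ h₂ h₃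
  rw [torsionSectorComplete_iff]
  intro n m r r' hr hr' hv
  have hR : NeronTorsionThirdKind := neronTorsionThirdKind_of h₁ h₂
  have hle : Literature.NumberTheory.Transcendental.KZ.relations ⊔ AddSubgroup.closure (TorsionTied ∪ ThirdKindTied) ≤
      Literature.NumberTheory.Transcendental.KZ.relations ⊔ AddSubgroup.closure TorsionTied := by
    refine sup_le le_sup_left ((AddSubgroup.closure_le _).mpr ?_)
    rintro d (hd | hd)
    · exact AddSubgroup.mem_sup_right (AddSubgroup.subset_closure hd)
    · exact AddSubgroup.mem_sup_left (closure_thirdKindTied_le_relations (hR true) (AddSubgroup.subset_closure hd))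
  exact hle (h₃ r r' hr hr' hv)

end Summit.KontsevichZagierPeriods.KontsevichZagierPeriods.Cruxes.TorsionSectorComplete.NeronTorsionThirdKind

end
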